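import Summits.KontsevichZagierPeriods.Zeta5Search.Barrier.ConeGammaLogLipschitz
import Summits.KontsevichZagierPeriods.Zeta5Search.Barrier.ConeGammaLogCuspGammaUniform

/-!
# ζ(5) search — BARRIER: the COVERING BALL — lattice directions, `Φ` uniformly on the ball, §2b's covering step for `γ`

HONEST FRAMING (cell `pub-zeta5`): systematic search; no irrationality claim unless kernel-certified. MODEL objects
under Brown–Zudilin's (28)+(30) accounting ([BZ22] = arXiv:2210.03391; (28) observed, not proved); nothing here is a
statement about `ζ(5)`, any `γ` of record or the cone's supremum (C2 = `BarrierC2` OPEN). The `Φ`-constants are the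
NO-CANCELLATION `σ₁`-scale constants of file (1) (`ConeGammaLogLipschitz`), outside the `BARRIER-PLAN.md` §2b
plausibility budget at every census level: the inequality below certifies NOTHING at any direction and moves no number
or sentence of record; S-E (the same inequality with the signed-jump-mass constant, `O(1)` uniformly in the level)
stays CONJECTURED; records in print UNMOVED. Prover P2 g39 (plan INBOX l.9788, lead/lit g40 GO + words «LOGLIPSCHITZ» +
conditions (a)–(g) l.9789), file (2) of two of the item «Φ is log-Lipschitz» (file (1) `ConeGammaLogLipschitz`).

THE POINT. `BARRIER-PLAN.md` §2b «WHY IT IS THE CRUX» describes the covering step in words: on a ball of radius `ρ`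
around a (Regular) rational direction, Lipschitz data for `C₁`, `C₀`, `δ₂₈` and a modulus for `Φ` turn the tree's
`gamma_le_of_bounds` into ONE bound for `γ` on the whole ball, so that covering the simplex by such balls around a
lattice reduces the cone bound (S-A) to a finite lattice table (S-D) plus the modulus (S-E). This file writes that step
as a kernel inequality with every constant explicit, the `Φ`-modulus being file (1)'s hypothesis-free one:
* `BZBox_perturb_of_margin`, `inv_le_of_lattice_pos`, `hper_of_lattice`, **`abs_phi30_sub_le_of_lattice`** — at a
  LATTICE direction of the open box (`T·s_j(a) ∈ ℤ`, `j = 0..7`, written out as a hypothesis) the period, `x_min ≥ 1/T`,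
  the margin and the box membership are automatic: file (1)'s modulus holds for EVERY `η` with `0 < Y(η) ≤ 1/(4T)`, no
  side condition (that ball contains the sup-norm ball of radius `1/(8T)` — S-E's covering radius `1/(2λ₀)` up to the
  absolute factor `4`, a comparison made in this docstring only; NOT a usable bound, nothing certified);
* `mul_log_inv_le` — `Y·log(1/(TY)) ≤ ρ·(log(1/(Tρ)) + 1)` for `0 < Y ≤ ρ`, `Tρ ≤ 1` (the `x·log(1/x)` majorant is
  dominated uniformly on the ball although it is not monotone);
* `eq_zero_of_shiftSize_eq_zero` — `Y(η) = 0 ⇒ η = 0`;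
* **`abs_phi30_sub_le_on_ball`**, `phi30_le_add_on_ball` — UNIFORM on the `Y`-ball of radius `ρ` (`Tρ ≤ 1`,
  `ρ ≤ x_min/2`): `|Φ(s(a)+η) − Φ(a)| ≤ ρ·(28·log(1/(Tρ)) + 28·log(T·x_max+1) + 203)` for EVERY `η` with `Y(η) ≤ ρ`
  and `s(a)+η` in the closed box — ONE number for the whole ball, hypothesis-free;
* **`gamma_le_on_ball_of_calm`** — CONDITIONAL on two-sided calm data `|C_i(s(a)+η) − C_i(a)| ≤ L·Y(η)` for `Y(η) ≤ ρ`
  (`i = 0, 1`; a HYPOTHESIS — the shape of P2 g38's `exists_calm_C1_C0_of_regular` at Regular open-box directions and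
  of cert-2's box certificates, none of which is imported) and on `Regular` at the displaced direction, with
  `M = ρ·(28·log(1/(Tρ)) + 28·log(T·x_max+1) + 203)` and the two positivity margins `0 < C₁ − Lρ + δ₂₈ − 25ρ − Φ − M`,
  `0 ≤ C₀ − Lρ + δ₂₈ − 25ρ − Φ − M` at `a`: for EVERY `η` with `Y(η) ≤ ρ` and `s(a)+η` in the closed box,
  **`γ(s(a)+η) ≤ (C₁ − C₀ + 2Lρ)/(C₁ + Lρ + δ₂₈ − 25ρ − Φ − M)`** (all of `C₁, C₀, δ₂₈, Φ` at `a`) — the tree's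
  `gamma_le_of_bounds` with `C₁⁺ = C₁ + Lρ`, `C₀⁻ = C₀ − Lρ`, `δ⁻ = δ₂₈ − 25ρ` (g38's `abs_delta28_sub_le_shiftSize`),
  `Φ⁺ = Φ + M`; `gamma_le_on_ball_of_calm'` — §2b's displayed (weaker) shape with `C₁ − Lρ` in the denominator.
READING: the covering step is a theorem; what decides whether it certifies anything is the SIZE of `M` at the
covering radius, i.e. S-E's constant — with the present no-cancellation `M` it certifies nothing. The EXISTENTIAL
log-Lipschitz modulus of `γ` at Regular open-box rational directions is already P2 g38's `abs_gamma_sub_le_of_regular`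
and is not restated. NOT here (honest): any value of `L`, `ρ`, `M`, `γ` at a named direction; S-E; C2; `ζ(5)`.
-/

noncomputable section

open Set MeasureTheory
open scoped Topology

namespace Summit.KontsevichZagierPeriods.Zeta5Search.Barrier.ConeGamma

/-! ### Lattice directions: every side condition is automatic -/

/-- **A displacement of form size at most a quarter of the margin keeps the direction in the closed box**: if
`0 < m ≤ s_j(a)` and `m ≤ s₀(a) − s_j(a)` for `j = 1..7` and `Y(η) ≤ m/4`, then `aOfS (s(a) + η)` is in the closed box
(`|η₀| ≤ (3/2)Y`, `|η_j| ≤ (5/2)Y`). -/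
theorem BZBox_perturb_of_margin {a : Dir} {m : ℝ} (hm0 : 0 < m)
    (hm : ∀ j : Fin 7, m ≤ sParam a j.succ ∧ m ≤ sParam a 0 - sParam a j.succ)
    (η : Fin 8 → ℝ) (hY : shiftSize η ≤ m / 4) : BZBox (aOfS (sParam a + η)) := by
  have hY0 := shiftSize_nonneg η
  have h0 := abs_le.mp (abs_apply_zero_le_shiftSize η)
  have hsucc : ∀ j : Fin 7, |η j.succ| ≤ 5 / 2 * shiftSize η := fun j => abs_apply_succ_le_shiftSize η j
  have hs1 := (hm 0).1
  have hs10 := (hm 0).2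
  unfold BZBox
  rw [sParam_aOfS]
  simp only [Pi.add_apply]
  refine ⟨?_, fun j => ⟨?_, ?_⟩⟩
  · have := abs_le.mp (hsucc 0)
    simp only [Fin.succ_zero_eq_one] at this hs1 hs10
    linarith [this.1, h0.1]
  · have := abs_le.mp (hsucc j); have := (hm j).1; linarith
  · have := abs_le.mp (hsucc j); have := (hm j).2; linarith

/-- A positive number of the lattice `(1/T)ℤ` is at least `1/T`. -/
theorem inv_le_of_lattice_pos {T r : ℝ} (hT : 0 < T) (hz : ∃ z : ℤ, T * r = z) (hr : 0 < r) : 1 / T ≤ r := by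
  obtain ⟨z, hz⟩ := hz
  have hz1 : (1 : ℝ) ≤ z := by
    have h : (0 : ℝ) < z := by rw [← hz]; exact mul_pos hT hr
    exact_mod_cast (show (1 : ℤ) ≤ z by exact_mod_cast h)
  rw [div_le_iff₀ hT]
  linarith

/-- **The forms of a lattice direction are lattice numbers**: if `T·s_j(a) ∈ ℤ` for `j = 0..7` then `T·h_k(a) ∈ ℤ` for
all 28 forms (`h_k = s_i + s_j` or `s₀ − s_j`), i.e. `T` is a period of the orbit. -/
theorem hper_of_lattice {a : Dir} {T : ℝ} (hlat : ∀ j : Fin 8, ∃ z : ℤ, T * sParam a j = z) :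
    ∀ k : Fin 28, ∃ z : ℤ, T * h28 a k = z := by
  choose z hz using hlat
  have hadd : ∀ i j : Fin 8, ∃ w : ℤ, T * (sParam a i + sParam a j) = w := fun i j =>
    ⟨z i + z j, by push_cast; rw [mul_add, hz, hz]⟩
  have hsub : ∀ j : Fin 8, ∃ w : ℤ, T * (sParam a 0 - sParam a j) = w := fun j =>
    ⟨z 0 - z j, by push_cast; rw [mul_sub, hz, hz]⟩
  have e : h28 a = h28 (aOfS (sParam a)) := by rw [aOfS_sParam]
  intro k
  rw [e, h28_aOfS]
  fin_cases k
  all_goals simp only [Fin.reduceFinMk, Matrix.cons_val]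
  all_goals first | exact hadd _ _ | exact hsub _

/-- **`Φ` IS LOG-LIPSCHITZ AT EVERY LATTICE DIRECTION OF THE OPEN BOX, WITH NO SIDE CONDITION.** If `a` lies in the open
box (`0 < s_j(a) < s₀(a)`, `j = 1..7`) and is a lattice direction of level `T > 0` (`T·s_j(a) ∈ ℤ`, `j = 0..7`), then
for EVERY displacement `η` with `0 < Y(η) ≤ 1/(4T)`:
**`|Φ(s(a)+η) − Φ(a)| ≤ σ₁(η)·(log(1/(T·Y(η))) + log(T·x_max+1) + 6) + 7·Y(η)`**
(period, positivity `x_min ≥ 1/T`, margin `≥ 1/T` and box membership are automatic at a lattice point). The ball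
`Y ≤ 1/(4T)` contains the sup-norm ball of radius `1/(8T)`: S-E's covering radius `1/(2λ₀)` up to the absolute factor
`4` (covering the height-one simplex by these balls costs the level-`4λ₀` lattice — LATTICE cost, as §2b wants —
but with the present no-cancellation constants the resulting bound is far outside the §2b budget at every census
level — NOT a usable bound, NOTHING is certified; S-E's content is the constant; S-E / S-E′ CONJECTURED). -/
theorem abs_phi30_sub_le_of_lattice {a : Dir}
    (hopen : ∀ j : Fin 7, 0 < sParam a j.succ ∧ sParam a j.succ < sParam a 0)
    {T : ℝ} (hT : 0 < T) (hlat : ∀ j : Fin 8, ∃ z : ℤ, T * sParam a j = z) (η : Fin 8 → ℝ)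
    (hY : 0 < shiftSize η) (hYT : shiftSize η ≤ 1 / (4 * T)) :
    |phi30 (aOfS (sParam a + η)) - phi30 a|
      ≤ (∑ i, |phiForm η i|) * (Real.log (1 / (T * shiftSize η)) + Real.log (T * xMax a + 1) + 6)
        + 7 * shiftSize η := by
  have hpos := h28_pos_of_openBox hopen
  have ha := BZBox_of_openBox hopen
  have hper := hper_of_lattice hlat
  have hT4 : 1 / (4 * T) ≤ 1 / T := by
    rw [div_le_div_iff₀ (by linarith) hT]; linarith
  -- `x_min ≥ 1/T`
  have hxmin : 1 / T ≤ xMin a := by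
    obtain ⟨k, hk⟩ := Finset.exists_mem_eq_inf' Finset.univ_nonempty (h28 a)
    rw [xMin, hk.2]
    exact inv_le_of_lattice_pos hT (hper k) (hpos k)
  -- margin `≥ 1/T`
  have hm : ∀ j : Fin 7, 1 / T ≤ sParam a j.succ ∧ 1 / T ≤ sParam a 0 - sParam a j.succ := by
    intro j
    refine ⟨inv_le_of_lattice_pos hT (hlat j.succ) (hopen j).1, inv_le_of_lattice_pos hT ?_ (sub_pos.mpr (hopen j).2)⟩
    obtain ⟨z0, hz0⟩ := hlat 0
    obtain ⟨zj, hzj⟩ := hlat j.succ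
    exact ⟨z0 - zj, by push_cast; rw [mul_sub, hz0, hzj]⟩
  have hbox : BZBox (aOfS (sParam a + η)) :=
    BZBox_perturb_of_margin (div_pos one_pos hT) hm η (hYT.trans (le_of_eq (by rw [div_div, mul_comm T 4])))
  have hYT' : T * shiftSize η ≤ 1 := by
    have := mul_le_mul_of_nonneg_left (hYT.trans hT4) hT.le
    rwa [mul_one_div_cancel hT.ne'] at this
  have hYx : shiftSize η ≤ xMin a / 2 := by
    have : 1 / (4 * T) ≤ (1 / T) / 2 := by
      rw [div_div, div_le_div_iff₀ (by linarith) (by linarith)]; linarith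
    linarith
  exact abs_phi30_sub_le_nhds_explicit ha hpos hT hper η hY hYT' hYx hbox


/-! ### Two scalar facts -/

/-- **The `x·log(1/x)` majorant is dominated uniformly on a ball**: for `0 < Y ≤ ρ` and `T·ρ ≤ 1` (`T > 0`),
`Y·log(1/(T·Y)) ≤ ρ·(log(1/(T·ρ)) + 1)` (`log(1/(TY)) = log(1/(Tρ)) + log(ρ/Y)` and `Y·log(ρ/Y) ≤ ρ − Y`). -/
theorem mul_log_inv_le {T Y ρ : ℝ} (hT : 0 < T) (hY : 0 < Y) (hYρ : Y ≤ ρ) (hρ : T * ρ ≤ 1) :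
    Y * Real.log (1 / (T * Y)) ≤ ρ * (Real.log (1 / (T * ρ)) + 1) := by
  have hρ0 : 0 < ρ := hY.trans_le hYρ
  have h1 : Real.log (1 / (T * Y)) = Real.log (1 / (T * ρ)) + Real.log (ρ / Y) := by
    rw [← Real.log_mul (div_pos one_pos (mul_pos hT hρ0)).ne' (div_pos hρ0 hY).ne']
    congr 1
    field_simp
  have h2 : Real.log (ρ / Y) ≤ ρ / Y - 1 := Real.log_le_sub_one_of_pos (div_pos hρ0 hY)
  have h3 : 0 ≤ Real.log (1 / (T * ρ)) := by
    refine Real.log_nonneg ?_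
    rw [le_div_iff₀ (mul_pos hT hρ0)]; linarith
  have e : Y * (ρ / Y - 1) = ρ - Y := by field_simp
  rw [h1, mul_add]
  have h4 : Y * Real.log (ρ / Y) ≤ ρ - Y := by
    rw [← e]; exact mul_le_mul_of_nonneg_left h2 hY.le
  have h5 : Y * Real.log (1 / (T * ρ)) ≤ ρ * Real.log (1 / (T * ρ)) := mul_le_mul_of_nonneg_right hYρ h3
  nlinarith

/-- A displacement of form size `0` is `0` (`|η₀| ≤ (3/2)Y`, `|η_j| ≤ (5/2)Y`). -/
theorem eq_zero_of_shiftSize_eq_zero {η : Fin 8 → ℝ} (h : shiftSize η = 0) : η = 0 := by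
  funext i
  refine Fin.cases ?_ (fun j => ?_) i
  · have h0 := abs_apply_zero_le_shiftSize η
    rw [h, mul_zero] at h0
    exact abs_nonpos_iff.mp h0
  · have hj := abs_apply_succ_le_shiftSize η j
    rw [h, mul_zero] at hj
    exact abs_nonpos_iff.mp hj

/-! ### `Φ` on the covering ball, uniformly -/

/-- **`Φ` ON THE COVERING BALL, UNIFORMLY AND TWO-SIDEDLY, HYPOTHESIS-FREE.** `a` in the closed box with all 28 forms
positive, `T > 0` a period, `ρ` a radius with `T·ρ ≤ 1` and `ρ ≤ x_min/2`. For EVERY displacement `η` with `Y(η) ≤ ρ` and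
`s(a)+η` in the closed box: `|Φ(s(a)+η) − Φ(a)| ≤ ρ·(28·log(1/(T·ρ)) + 28·log(T·x_max+1) + 203)` — ONE number for the
whole ball (file (1)'s `abs_phi30_sub_le_shiftSize_explicit` + `mul_log_inv_le`; the no-cancellation `σ₁`-scale
constant, NOT S-E's — NOT a usable bound, nothing certified). -/
theorem abs_phi30_sub_le_on_ball {a : Dir} (ha : BZBox a) (hpos : ∀ k, 0 < h28 a k) {T : ℝ} (hT : 0 < T)
    (hper : ∀ k : Fin 28, ∃ z : ℤ, T * h28 a k = z) {ρ : ℝ} (hρT : T * ρ ≤ 1) (hρx : ρ ≤ xMin a / 2)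
    (η : Fin 8 → ℝ) (hYρ : shiftSize η ≤ ρ) (hbox : BZBox (aOfS (sParam a + η))) :
    |phi30 (aOfS (sParam a + η)) - phi30 a|
      ≤ ρ * (28 * Real.log (1 / (T * ρ)) + 28 * Real.log (T * xMax a + 1) + 203) := by
  have hL : 0 ≤ Real.log (T * xMax a + 1) := by
    refine Real.log_nonneg ?_
    have := mul_pos hT (xMax_pos hpos); linarith
  rcases (shiftSize_nonneg η).eq_or_lt with h0 | hY
  · -- `Y(η) = 0`: `η = 0`, the displaced direction is `a` itself
    have hη : η = 0 := eq_zero_of_shiftSize_eq_zero h0.symm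
    rw [hη, add_zero, aOfS_sParam, sub_self, abs_zero]
    have hρ0 : 0 ≤ ρ := by rw [h0]; exact hYρ
    rcases hρ0.eq_or_lt with hρz | hρp
    · rw [← hρz]; simp
    · have h3 : 0 ≤ Real.log (1 / (T * ρ)) := by
        refine Real.log_nonneg ?_
        rw [le_div_iff₀ (mul_pos hT hρp)]; linarith
      nlinarith
  · have hYT : T * shiftSize η ≤ 1 := by nlinarith
    have hYx : shiftSize η ≤ xMin a / 2 := hYρ.trans hρx
    have h := abs_phi30_sub_le_shiftSize_explicit ha hpos hT hper η hY hYT hYx hbox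
    have hlog := mul_log_inv_le hT hY hYρ hρT
    nlinarith

/-- **`Φ` ON THE COVERING BALL, UNIFORMLY (upper side).** Under the same hypotheses,
`Φ(s(a)+η) ≤ Φ(a) + ρ·(28·log(1/(T·ρ)) + 28·log(T·x_max+1) + 203)`. -/
theorem phi30_le_add_on_ball {a : Dir} (ha : BZBox a) (hpos : ∀ k, 0 < h28 a k) {T : ℝ} (hT : 0 < T)
    (hper : ∀ k : Fin 28, ∃ z : ℤ, T * h28 a k = z) {ρ : ℝ} (hρT : T * ρ ≤ 1) (hρx : ρ ≤ xMin a / 2)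
    (η : Fin 8 → ℝ) (hYρ : shiftSize η ≤ ρ) (hbox : BZBox (aOfS (sParam a + η))) :
    phi30 (aOfS (sParam a + η))
      ≤ phi30 a + ρ * (28 * Real.log (1 / (T * ρ)) + 28 * Real.log (T * xMax a + 1) + 203) := by
  have h := (abs_le.mp (abs_phi30_sub_le_on_ball ha hpos hT hper hρT hρx η hYρ hbox)).2
  linarith

/-! ### The covering inequality for `γ` -/

/-- **THE COVERING STEP OF `BARRIER-PLAN.md` §2b AS ONE KERNEL INEQUALITY.** `a` in the closed box with all 28 forms
positive, `T > 0` a period, `ρ` a radius with `T·ρ ≤ 1`, `ρ ≤ x_min/2`; CALM data (a HYPOTHESIS, `L ≥ 0`): `|C₁(s(a)+η) −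
C₁(a)| ≤ L·Y(η)` and `|C₀(s(a)+η) − C₀(a)| ≤ L·Y(η)` whenever `Y(η) ≤ ρ`; with
`M = ρ·(28·log(1/(Tρ)) + 28·log(T·x_max+1) + 203)` the margins `0 < C₁(a) − Lρ + δ₂₈(a) − 25ρ − Φ(a) − M` and
`0 ≤ C₀(a) − Lρ + δ₂₈(a) − 25ρ − Φ(a) − M` (the «`μ₁`-analogue»: the resulting bound is `≤ 1`). Then for EVERY
displacement `η` with `Y(η) ≤ ρ`, `s(a)+η` in the closed box and `Regular` there:
**`γ(s(a)+η) ≤ (C₁(a) − C₀(a) + 2Lρ)/(C₁(a) + Lρ + δ₂₈(a) − 25ρ − Φ(a) − M)`** — ONE number for the whole ball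
(`gamma_le_of_bounds` with `C₁⁺ = C₁ + Lρ`, `C₀⁻ = C₀ − Lρ`, `δ⁻ = δ₂₈ − 25ρ`, `Φ⁺ = Φ + M`). HONEST: `M` is the
no-cancellation modulus of file (1), outside the §2b budget at every census level, so this certifies NOTHING at any
direction; with S-E's (CONJECTURED) constant in place of `M` it is the mechanism §2b describes; no value of `L`, `ρ`,
`M` or `γ` at a named direction is asserted; nothing about C2 or `ζ(5)`. -/
theorem gamma_le_on_ball_of_calm {a : Dir} (ha : BZBox a) (hpos : ∀ k, 0 < h28 a k) {T : ℝ} (hT : 0 < T)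
    (hper : ∀ k : Fin 28, ∃ z : ℤ, T * h28 a k = z) {L ρ : ℝ} (hL : 0 ≤ L) (hρT : T * ρ ≤ 1)
    (hρx : ρ ≤ xMin a / 2)
    (hC1 : ∀ η : Fin 8 → ℝ, shiftSize η ≤ ρ → |C1 (aOfS (sParam a + η)) - C1 a| ≤ L * shiftSize η)
    (hC0 : ∀ η : Fin 8 → ℝ, shiftSize η ≤ ρ → |C0 (aOfS (sParam a + η)) - C0 a| ≤ L * shiftSize η)
    (hQ : 0 < C1 a - L * ρ + (delta28 a - 25 * ρ)
      - (phi30 a + ρ * (28 * Real.log (1 / (T * ρ)) + 28 * Real.log (T * xMax a + 1) + 203)))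
    (hμ : 0 ≤ C0 a - L * ρ + (delta28 a - 25 * ρ)
      - (phi30 a + ρ * (28 * Real.log (1 / (T * ρ)) + 28 * Real.log (T * xMax a + 1) + 203)))
    (η : Fin 8 → ℝ) (hYρ : shiftSize η ≤ ρ) (hbox : BZBox (aOfS (sParam a + η)))
    (hreg : Regular (aOfS (sParam a + η))) :
    gamma (aOfS (sParam a + η))
      ≤ (C1 a + L * ρ - (C0 a - L * ρ))
        / (C1 a + L * ρ + (delta28 a - 25 * ρ)
          - (phi30 a + ρ * (28 * Real.log (1 / (T * ρ)) + 28 * Real.log (T * xMax a + 1) + 203))) := by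
  have hLY : L * shiftSize η ≤ L * ρ := mul_le_mul_of_nonneg_left hYρ hL
  have h1 := abs_le.mp (hC1 η hYρ)
  have h0 := abs_le.mp (hC0 η hYρ)
  have hδ := abs_le.mp (abs_delta28_sub_le_shiftSize a η)
  have hΦ := phi30_le_add_on_ball ha hpos hT hper hρT hρx η hYρ hbox
  exact gamma_le_of_bounds hreg (by linarith [h1.2]) (by linarith [h0.1]) (by linarith [hδ.1]) hΦ
    (by linarith [h1.1]) hμ

/-- **§2b's displayed shape** (weaker: `C₁ − Lρ` in the denominator). Under the hypotheses of
`gamma_le_on_ball_of_calm` and `C₀(a) ≤ C₁(a)`: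
`γ(s(a)+η) ≤ (C₁ + Lρ − (C₀ − Lρ))/(C₁ − Lρ + δ₂₈ − 25ρ − Φ − M)` — the sentence «`γ(t) ≤ (C₁(t₀) + L₁ρ − C₀(t₀) +
L₀ρ)/(C₁(t₀) − L₁ρ + δ₂₈(t₀) − L_δρ − Φ(t₀) − A(t₀)ρ(1 + ln⁺(1/(λ₀ρ))))`» of `BARRIER-PLAN.md` §2b with `L_δ = 25` and
file (1)'s explicit no-cancellation modulus (constant `∝ log T`, outside the §2b budget) in place of S-E's `A(t₀)` — NOT
a usable bound, nothing certified; S-E's content is the constant; S-E / S-E′ CONJECTURED. -/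
theorem gamma_le_on_ball_of_calm' {a : Dir} (ha : BZBox a) (hpos : ∀ k, 0 < h28 a k) {T : ℝ} (hT : 0 < T)
    (hper : ∀ k : Fin 28, ∃ z : ℤ, T * h28 a k = z) {L ρ : ℝ} (hL : 0 ≤ L) (hρ : 0 ≤ ρ) (hρT : T * ρ ≤ 1)
    (hρx : ρ ≤ xMin a / 2) (hC : C0 a ≤ C1 a)
    (hC1 : ∀ η : Fin 8 → ℝ, shiftSize η ≤ ρ → |C1 (aOfS (sParam a + η)) - C1 a| ≤ L * shiftSize η)
    (hC0 : ∀ η : Fin 8 → ℝ, shiftSize η ≤ ρ → |C0 (aOfS (sParam a + η)) - C0 a| ≤ L * shiftSize η)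
    (hQ : 0 < C1 a - L * ρ + (delta28 a - 25 * ρ)
      - (phi30 a + ρ * (28 * Real.log (1 / (T * ρ)) + 28 * Real.log (T * xMax a + 1) + 203)))
    (hμ : 0 ≤ C0 a - L * ρ + (delta28 a - 25 * ρ)
      - (phi30 a + ρ * (28 * Real.log (1 / (T * ρ)) + 28 * Real.log (T * xMax a + 1) + 203)))
    (η : Fin 8 → ℝ) (hYρ : shiftSize η ≤ ρ) (hbox : BZBox (aOfS (sParam a + η)))
    (hreg : Regular (aOfS (sParam a + η))) :
    gamma (aOfS (sParam a + η))
      ≤ (C1 a + L * ρ - (C0 a - L * ρ))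
        / (C1 a - L * ρ + (delta28 a - 25 * ρ)
          - (phi30 a + ρ * (28 * Real.log (1 / (T * ρ)) + 28 * Real.log (T * xMax a + 1) + 203))) := by
  have h := gamma_le_on_ball_of_calm ha hpos hT hper hL hρT hρx hC1 hC0 hQ hμ η hYρ hbox hreg
  refine h.trans (div_le_div_of_nonneg_left ?_ hQ ?_)
  · nlinarith
  · nlinarith

end Summit.KontsevichZagierPeriods.Zeta5Search.Barrier.ConeGamma

end
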